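import Mathlib
import HarnessLib
import Literature.Analysis.FluidPDE.Tao2016AveragedNS.LocalCascadeSolutions
import Literature.Analysis.FluidPDE.Tao2016AveragedNS.RenormalisedCascadeWaves
import Literature.Analysis.FluidPDE.Tao2016AveragedNS.SelfSimilarCascadeBlowup
import Literature.Analysis.FluidPDE.Tao2016AveragedNS.BoundedEternalSolutions
import Summits.NavierStokesRegularity.NavierStokesRegularity.Theses.TaoLadderRungTwoBreak
import Summits.NavierStokesRegularity.NavierStokesRegularity.Theorems.TransitMassLedgerActionTransitExtractionSmallAmplitudeRung

/-!
# BC5 WITNESS RUNG for K1(1) `TaoLadderRungTwoBreak.NoSurvivingDSSOne` (stmt-NavierStokesRegularity-20205):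
# the AMPLITUDE QUANTUM FOR ADMISSIBLE DSS BLOW-UP WAVES — a profile family of sup-norm `< 1/K(α, ε₀)` is
# trivial (surviving or not)

MODEL lattice ODEs only (Tao 2016 §4 in the variables of §6.4); nothing here is a statement about the
Navier–Stokes equations; no summit or rung LEAF is proved (`--supports stmt-NavierStokesRegularity-20205 --as
helper`).

The tree's inviscid small-amplitude Liouville theorem (`…SmallAmplitudeRung.eq_zero_of_small`,
TransitMassLedger lane: a bounded admissible eternal solution with `sup ‖W‖ ≤ δ`, `K δ < 1`, is zero)
transported to DSS waves through the shell-wise embedding `dssEmbed` (every profile value IS a value of the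
embedded eternal solution, `IsDSSWave.isEternal_dssEmbed`):

* `dssWave_eq_zero_of_small` — an admissible DSS wave of ANY table (any size, any period `q`, shape
  permutation, delay) at any `ε₀ > 0` whose profiles obey `‖Φ_r(x)‖ ≤ δ` with `K(α, ε₀) δ < 1` is TRIVIAL —
  no survival hypothesis: the amplitude quantum `sup_{r,x} ‖Φ_r(x)‖ ≥ 1/K` for every non-trivial admissible
  DSS blow-up wave (`exists_norm_gt_of_dssWave_ne_zero`);
* `noSurvivingDSSOne_smallAmplitude` — the rung in K1(1)'s quantifier shape (threshold `εs = 1`, uniform in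
  `R`, `K ≤ 704` on E₂(R)): PROVED, and a case of the crux (`smallAmplitude_of_noSurvivingDSSOne`).

HONEST CLAUSE: a witness of weakness; the surviving fronts K1(1) must exclude (the cell's screens: coherent
self-similar fronts down to `ε₀ ≈ 0.0125`) have amplitude `≥ 1/704`; ⟨20205⟩ stays OPEN.
-/

noncomputable section

-- the summit and its single sub-problem share the name (CONVENTIONS §1)
set_option linter.dupNamespace false

namespace Summit.NavierStokesRegularity.NavierStokesRegularity.Theorems.NoSurvivingDSSOne.SmallAmplitude

open Literature.Analysis.FluidPDE Literature.Analysis.FluidPDE.TaoCascade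
open Summit.NavierStokesRegularity.NavierStokesRegularity.Cruxes.ActionTransitExtraction.SmallAmplitudeRung
  (quadConst quadConst_nonneg quadConst_le eq_zero_of_small)
open Summit.NavierStokesRegularity.NavierStokesRegularity.Theses.TaoLadderRungTwoBreak

variable {m : ℕ} {ρ : Type*} [Fintype ρ] {ε₀ : ℝ} {α : Fin m → Fin m → Fin m → ℤ × ℤ × ℤ → ℝ}

/-- **Small admissible DSS waves are trivial.**  If `Φ` is the profile family of an admissible DSS wave of the
table `α` at scale ratio `1+ε₀` and `‖Φ_r(x)‖ ≤ δ` for all profiles and phases with `K(α, ε₀) δ < 1`, then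
`Φ ≡ 0` (embed along the orbit of `r`, apply the small-amplitude Liouville theorem, read off shell `0`).
[cite: Tao2016AveragedNS, §4 (4.1)–(4.4), Lemma 4.1 (4.8), §6.4; tree: `eq_zero_of_small`, `IsDSSWave.isEternal_dssEmbed`] -/
theorem dssWave_eq_zero_of_small (hε : 0 < ε₀) {π : Equiv.Perm ρ} {T : ℝ} {Φ : ρ → ℝ → Em m}
    (hW : IsDSSWave ε₀ α π T Φ) {δ : ℝ} (hδ : ∀ (r : ρ) (x : ℝ), ‖Φ r x‖ ≤ δ)
    (hsmall : quadConst ε₀ α * δ < 1) : ∀ (r : ρ) (x : ℝ), Φ r x = 0 := by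
  intro r x
  have hE : IsEternal ε₀ α (dssEmbed π T Φ r) := hW.isEternal_dssEmbed r
  have hb : ∀ (k : ℤ) (σ : ℝ), ‖dssEmbed π T Φ r k σ‖ ≤ δ := fun k σ => hδ _ _
  have h0 := eq_zero_of_small hε hE hb hsmall 0 x
  simpa [dssEmbed] using h0

/-- **The amplitude quantum for DSS blow-up waves**: a non-trivial admissible DSS wave exceeds every level
`δ` with `K δ < 1` at some profile and phase.
[cite: Tao2016AveragedNS, §4 (4.1)–(4.4), §6.4; cell vocabulary] -/
theorem exists_norm_gt_of_dssWave_ne_zero (hε : 0 < ε₀) {π : Equiv.Perm ρ} {T : ℝ} {Φ : ρ → ℝ → Em m}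
    (hW : IsDSSWave ε₀ α π T Φ) (hne : ∃ (r : ρ) (x : ℝ), Φ r x ≠ 0) {δ : ℝ}
    (hsmall : quadConst ε₀ α * δ < 1) : ∃ (r : ρ) (x : ℝ), δ < ‖Φ r x‖ := by
  by_contra! hcon
  obtain ⟨r, x, hr⟩ := hne
  exact hr (dssWave_eq_zero_of_small hε hW hcon hsmall r x)

/-- On E₂(R) with `ε₀ ≤ 1` (`K ≤ 704`): an admissible DSS wave with profile sup-norm `≤ 1/1000` is trivial.
[cite: Tao2016AveragedNS, §4 (4.1)–(4.4), §6.4; tree: `quadConst_le`] -/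
theorem dssWave_eq_zero_of_le_milli {R : ℝ} {α : Fin 4 → Fin 4 → Fin 4 → ℤ × ℤ × ℤ → ℝ} (hε : 0 < ε₀)
    (hε1 : ε₀ ≤ 1) (hα : InTableClass R α) {q : ℕ} {π : Equiv.Perm (Fin q)} {T : ℝ}
    {Φ : Fin q → ℝ → Em 4} (hW : IsDSSWave ε₀ α π T Φ) (hδ : ∀ (r : Fin q) (x : ℝ), ‖Φ r x‖ ≤ 1 / 1000) :
    ∀ (r : Fin q) (x : ℝ), Φ r x = 0 := by
  have hK := quadConst_le hε hε1 hα
  have hlt : quadConst ε₀ α * (1 / 1000) < 1 := by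
    have : quadConst ε₀ α * (1 / 1000) ≤ 704 * (1 / 1000) := mul_le_mul_of_nonneg_right hK (by norm_num)
    linarith
  exact dssWave_eq_zero_of_small hε hW hδ hlt

/-- **K1(1)-RUNG (small amplitude), PROVED** (threshold `εs = 1`, uniform in `R`; the survival hypothesis is
not even used): below `ε₀ ≤ 1`, every admissible DSS wave of an E₂(R) table with profile sup-norm `≤ 1/1000`
that is (S₁)-surviving is trivial.
[cite: Tao2016AveragedNS, §4 Thm. 4.2 (statement shape), (4.1)–(4.4), §6.4; cell vocabulary] -/
theorem noSurvivingDSSOne_smallAmplitude :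
    ∀ R : ℝ, 1 ≤ R → ∃ εs : ℝ, 0 < εs ∧ ∀ ε₀ : ℝ, 0 < ε₀ → ε₀ ≤ εs →
      ∀ α : Fin 4 → Fin 4 → Fin 4 → ℤ × ℤ × ℤ → ℝ, InTableClass R α →
        ∀ (q : ℕ) (π : Equiv.Perm (Fin q)) (T : ℝ) (Φ : Fin q → ℝ → Em 4),
          IsDSSWave ε₀ α π T Φ → Surviving 1 ε₀ T → (∀ (r : Fin q) (x : ℝ), ‖Φ r x‖ ≤ 1 / 1000) →
            ∀ r x, Φ r x = 0 := by
  intro R _hR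
  exact ⟨1, one_pos, fun ε₀ hε hε1 α hα q π T Φ hW _ hδ => dssWave_eq_zero_of_le_milli hε hε1 hα hW hδ⟩

/-- The rung IS a case of the crux K1(1) `NoSurvivingDSSOne` (forget the amplitude hypothesis).
[cite: Tao2016AveragedNS, §4 Thm. 4.2 (statement shape), §6.4; cell vocabulary] -/
theorem smallAmplitude_of_noSurvivingDSSOne (h : NoSurvivingDSSOne) :
    ∀ R : ℝ, 1 ≤ R → ∃ εs : ℝ, 0 < εs ∧ ∀ ε₀ : ℝ, 0 < ε₀ → ε₀ ≤ εs →
      ∀ α : Fin 4 → Fin 4 → Fin 4 → ℤ × ℤ × ℤ → ℝ, InTableClass R α →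
        ∀ (q : ℕ) (π : Equiv.Perm (Fin q)) (T : ℝ) (Φ : Fin q → ℝ → Em 4),
          IsDSSWave ε₀ α π T Φ → Surviving 1 ε₀ T → (∀ (r : Fin q) (x : ℝ), ‖Φ r x‖ ≤ 1 / 1000) →
            ∀ r x, Φ r x = 0 := by
  intro R hR
  obtain ⟨εs, hεs, H⟩ := h R hR
  exact ⟨εs, hεs, fun ε₀ hε hle α hα q π T Φ hW hS _ => H ε₀ hε hle α hα q π T Φ hW hS⟩

end Summit.NavierStokesRegularity.NavierStokesRegularity.Theorems.NoSurvivingDSSOne.SmallAmplitude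

end
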